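import Literature.Probability.RandomPlanarGeometry.SimpleCurves
import Literature.Probability.RandomPlanarGeometry.SimpleCurveLaws

/-!
# drefute stmt-CriticalPhenomena-4982 / line `marked-point-revisit` — Stub 1 `stub_shadowing`

Refuter's survival certificate for the deterministic stub 1 of
`Cruxes/SimpleSubseqLimits/Lines/marked-point-revisit.lean`: PROVED with the exact registered
signature (`ShadowConfig` verbatim, same namespace). Arc coordinate `f = η⁻¹ ∘ γ`
(`Curve.IsSimple.homeomorphRange`), `f 0 = 0`, `f` not monotone (else `γ` flat), first argmax of
`f` on `[0, q]` for a descent `p < q`, `f q < f p`, and two intermediate value theorems.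
-/

noncomputable section

open Set Metric Topology
open Literature.Probability.RandomPlanarGeometry
open scoped unitInterval

namespace Summit.CriticalPhenomena.SAWScalingLimit.Cruxes.SimpleSubseqLimits.MarkedPointRevisit

/-- verbatim from the skeleton -/
def ShadowConfig (η γ : Curve ℂ) (s t y₀ y₁ : I) : Prop :=
  s < t ∧ y₀ < y₁ ∧ γ s = η y₁ ∧ (∀ r : I, r < s → γ r ≠ η y₁) ∧
    (∀ r : I, r ≤ t → ∃ y : I, y ≤ y₁ ∧ γ r = η y) ∧
    ∀ y : I, y₀ ≤ y → y < y₁ →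
      (∃ r : I, r < s ∧ γ r = η y) ∧ (∃ r' : I, s < r' ∧ r' ≤ t ∧ γ r' = η y)

/-- The configuration from a descent `p < q`, `f q < f p`, of a continuous arc coordinate `f` with
`f 0 = 0` and `γ = η ∘ f`, `η` injective. -/
theorem shadowConfig_of_descent {η γ : Curve ℂ} (hη : η.IsSimple) {f : I → I} (hf : Continuous f)
    (hγf : ∀ u, γ u = η (f u)) (hf0 : f 0 = 0) {p q : I} (hpq : p < q) (hfpq : f q < f p) :
    ∃ s t y₀ y₁ : I, ShadowConfig η γ s t y₀ y₁ := by
  -- first argmax of `f` on `[0, q]`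
  obtain ⟨m, hm, hmax⟩ := (isCompact_Icc (a := (0 : I)) (b := q)).exists_isMaxOn
    ⟨p, unitInterval.nonneg', hpq.le⟩ hf.continuousOn
  set y₁ : I := f m with hy₁
  have hle : ∀ r : I, r ≤ q → f r ≤ y₁ := fun r hr => hmax ⟨unitInterval.nonneg', hr⟩
  set S : Set I := {r | r ≤ q ∧ f r = y₁} with hS
  have hSc : IsClosed S :=
    (isClosed_le continuous_id continuous_const).inter (isClosed_eq hf continuous_const)
  obtain ⟨s, ⟨hsq, hfs⟩, hsle⟩ := hSc.isCompact.exists_isLeast ⟨m, hm.2, rfl⟩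
  have hy01 : f q < y₁ := hfpq.trans_le (hle p hpq.le)
  have hsq' : s < q := lt_of_le_of_ne hsq (by rintro rfl; exact hy01.ne hfs)
  refine ⟨s, q, f q, y₁, hsq', hy01, by rw [hγf, hfs], ?_, ?_, ?_⟩
  · intro r hrs h
    rw [hγf] at h
    have hfr : f r = y₁ := hη h
    exact absurd (hsle ⟨hrs.le.trans hsq, hfr⟩) (not_le.2 hrs)
  · intro r hr
    exact ⟨f r, hle r hr, hγf r⟩
  · intro y hy0 hy1
    constructor
    · -- before `s`: IVT on `[0, s]`
      have hIVT := intermediate_value_Icc (unitInterval.nonneg' : (0 : I) ≤ s) hf.continuousOn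
      rw [hf0, hfs] at hIVT
      obtain ⟨r, ⟨-, hrs⟩, hfr⟩ := hIVT ⟨unitInterval.nonneg', hy1.le⟩
      have hrs' : r < s := lt_of_le_of_ne hrs (by rintro rfl; exact hy1.ne (hfr.symm.trans hfs))
      exact ⟨r, hrs', by rw [hγf, hfr]⟩
    · -- after `s`: IVT on `[s, q]`
      have hIVT := intermediate_value_Icc' hsq hf.continuousOn
      rw [hfs] at hIVT
      obtain ⟨r', ⟨hsr', hr'q⟩, hfr'⟩ := hIVT ⟨hy0, hy1.le⟩
      have hsr'' : s < r' := lt_of_le_of_ne hsr' (by rintro rfl; exact hy1.ne (hfr'.symm.trans hfs))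
      exact ⟨r', hsr'', hr'q, by rw [hγf, hfr']⟩

/-- **Stub 1, proved.** Exact registered signature of `stub_shadowing`. -/
theorem stub_shadowing :
    ∀ (η γ : Curve ℂ), η.IsSimple → Set.range γ = Set.range η → γ 0 = η 0 → ¬ γ.IsFlat →
      ∃ s t y₀ y₁ : I, ShadowConfig η γ s t y₀ y₁ := by
  intro η γ hη hrange h0 hnf
  -- the arc coordinate `f = η⁻¹ ∘ γ`
  have hmem : ∀ u, γ u ∈ Set.range η := fun u => hrange ▸ Set.mem_range_self u
  let f : I → I := fun u => hη.homeomorphRange.symm ⟨γ u, hmem u⟩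
  have hf : Continuous f :=
    hη.homeomorphRange.symm.continuous.comp (γ.continuous.subtype_mk hmem)
  have hγf : ∀ u, γ u = η (f u) := fun u => by
    have h := hη.coe_homeomorphRange_apply (hη.homeomorphRange.symm ⟨γ u, hmem u⟩)
    rw [Homeomorph.apply_symm_apply] at h
    exact h
  have hf0 : f 0 = 0 := hη ((hγf 0).symm.trans h0)
  -- `f` is not monotone, since `γ` is not flat
  have hdesc : ∃ p q : I, p < q ∧ f q < f p := by
    by_contra hmono
    push Not at hmono
    apply hnf
    intro s u t hsu hut hst
    have hfst : f s = f t := hη (by rw [← hγf, ← hγf, hst])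
    have h1 : f s ≤ f u := by
      rcases eq_or_lt_of_le hsu with h | h
      · rw [h]
      · exact hmono s u h
    have h2 : f u ≤ f t := by
      rcases eq_or_lt_of_le hut with h | h
      · rw [h]
      · exact hmono u t h
    have hfu : f u = f s := le_antisymm (hfst ▸ h2) h1
    rw [hγf, hγf s, hfu]
  obtain ⟨p, q, hpq, hfpq⟩ := hdesc
  exact shadowConfig_of_descent hη hf hγf hf0 hpq hfpq

end Summit.CriticalPhenomena.SAWScalingLimit.Cruxes.SimpleSubseqLimits.MarkedPointRevisit

end
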